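import Summits.SmoothPoincare4.SmoothPoincare4.Theorems.EntropyRungSubcylindricalExistenceTheoremA
import HarnessLib

/-!
# RoundBound: the round cap clears the threshold (stub `stub_roundEntropyBound`, line
`green-blowup-conformal-entropy`, crux `EntropyRung.SubcylindricalExistence`, item stmt-SmoothPoincare4-10871)

Stub B of the line: on a closed connected Riemannian 4-manifold of the summit binder (model
`ℝ⁴ = EuclideanSpace ℝ (Fin 4)`, `I = 𝓡 4`) with `Ric ≥ 3g` and `Vol ≥ 8π²/3 = Vol S⁴(1)` (the volume
hypothesis in `ℝ≥0∞` form), Perelman's `𝒲`-functional satisfies `log 6 − 2 ≤ 𝒲(g, f, τ)` for EVERY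
`τ > 0` and every smooth `f` with `∫ (4πτ)⁻² e^{-f} dV = 1`; `log 6 − 2 = ν(S⁴_round)`.

Proof: the total volume is finite (`riemannianVolume_lt_top_of_isCompact_holds`, `isCompact_univ`), so
the `ℝ≥0∞` hypothesis reads `8π²/3 ≤ Vol.toReal` (`ENNReal.ofReal_le_iff_le_toReal`); Theorem A of line
`curvature-dimension-entropy-floor` (`entropyVolumeComparison`, proved WITHOUT Perelman monotonicity by
the CD(3,4) entropy–energy inequality) gives `log Vol − 2 log(2π/3) − 2 ≤ 𝒲`, and
`log(8π²/3) − 2 log(2π/3) − 2 = log 6 − 2` with `Real.log_le_log`. Everything is proved; no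
definition, no named fact.

References: Bakry–Gentil–Ledoux, *Analysis and Geometry of Markov Diffusion Operators* (2014), §6
[BakryGentilLedoux2014]; Cao–Hamilton–Ilmanen (2004), Thm 3.4 [CaoHamiltonIlmanen2004];
Perelman (2002), §3 [Perelman2002Entropy].
-/

noncomputable section

-- the registered namespace `Summit.SmoothPoincare4.SmoothPoincare4.Theorems` repeats a component
set_option linter.dupNamespace false

open scoped Manifold ContDiff Topology ENNReal NNReal
open Set Filter MeasureTheory
open Literature.Geometry.Lorentzian Literature.Geometry.Riemannian

namespace Summit.SmoothPoincare4.SmoothPoincare4.Theorems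

/-- **RoundBound with the volume hypothesis as an inequality** (registered stub
`stub_roundEntropyBound` of line `green-blowup-conformal-entropy`): on a closed connected Riemannian
4-manifold with `Ric ≥ 3g` and `ENNReal.ofReal (8π²/3) ≤ Vol` (i.e. `Vol ≥ Vol S⁴(1)`), for every
`τ > 0` and every smooth `f` with `∫ (4πτ)⁻² e^{-f} dV = 1`, `log 6 − 2 ≤ 𝒲(g, f, τ)`. Theorem A
(`entropyVolumeComparison`: `log Vol − 2 log(2π/3) − 2 ≤ 𝒲`) and the monotonicity of `log`;
`[ConnectedSpace]` is load-bearing. [cite: CaoHamiltonIlmanen2004, Thm 3.4] -/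
theorem stub_roundEntropyBound :
    ∀ (N : Type) [TopologicalSpace N] [T2Space N] [SecondCountableTopology N]
      [ChartedSpace (EuclideanSpace ℝ (Fin 4)) N] [IsManifold (𝓡 4) ∞ N] [CompactSpace N]
      [ConnectedSpace N] [T3Space N] [MeasurableSpace N] [BorelSpace N]
      (g : PseudoRiemannianMetric (𝓡 4) ∞ (EuclideanSpace ℝ (Fin 4)) (TangentSpace (𝓡 4) : N → Type _))
      [g.HasLeviCivita] (hg : g.IsRiemannian),
      (∀ (x : N) (X : TangentSpace (𝓡 4) x), 3 * g.val x X X ≤ g.ricci x X X) →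
      ENNReal.ofReal (8 * Real.pi ^ 2 / 3) ≤ riemannianMeasure (g.toContMDiffRiemannianMetric hg) univ →
      ∀ τ : ℝ, 0 < τ → ∀ f : N → ℝ, ContMDiff (𝓡 4) 𝓘(ℝ, ℝ) ∞ f →
        ∫ x, (4 * Real.pi * τ) ^ (-(4 : ℝ) / 2) * Real.exp (-f x)
            ∂(riemannianMeasure (g.toContMDiffRiemannianMetric hg)) = 1 →
          Real.log 6 - 2 ≤
            ∫ x, (τ * (g.scalarCurvature x + g.gradSq f x) + f x - 4) *
                ((4 * Real.pi * τ) ^ (-(4 : ℝ) / 2) * Real.exp (-f x))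
              ∂(riemannianMeasure (g.toContMDiffRiemannianMetric hg)) := by
  intro N _ _ _ _ _ _ _ _ _ _ g _ hg hRic hVol τ hτ f hf hnorm
  -- Theorem A: `log Vol − 2 log(2π/3) − 2 ≤ 𝒲(g, f, τ)`
  have hW := entropyVolumeComparison N g hg hRic τ hτ f hf hnorm
  -- the total volume is finite, so the `ℝ≥0∞` hypothesis is `8π²/3 ≤ Vol.toReal`
  have hfin : riemannianMeasure (g.toContMDiffRiemannianMetric hg) univ ≠ ⊤ :=
    (riemannianVolume_lt_top_of_isCompact_holds (g.toContMDiffRiemannianMetric hg) le_rfl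
      isCompact_univ).ne
  have hle : 8 * Real.pi ^ 2 / 3 ≤ (riemannianMeasure (g.toContMDiffRiemannianMetric hg) univ).toReal :=
    (ENNReal.ofReal_le_iff_le_toReal hfin).1 hVol
  have hπ : 0 < Real.pi := Real.pi_pos
  have hV : 0 < 8 * Real.pi ^ 2 / 3 := by positivity
  have hlog : Real.log (8 * Real.pi ^ 2 / 3) ≤
      Real.log ((riemannianMeasure (g.toContMDiffRiemannianMetric hg) univ).toReal) :=
    Real.log_le_log hV hle
  -- `log(8π²/3) − 2 log(2π/3) − 2 = log 6 − 2`
  have h8 : Real.log 8 = 3 * Real.log 2 := by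
    rw [show (8 : ℝ) = 2 ^ 3 by norm_num, Real.log_pow]
    push_cast
    ring
  have hB : Real.log (8 * Real.pi ^ 2 / 3) = 3 * Real.log 2 + 2 * Real.log Real.pi - Real.log 3 := by
    rw [Real.log_div (by positivity) (by norm_num), Real.log_mul (by norm_num) (by positivity),
      Real.log_pow, h8]
    push_cast
    ring
  have h2 : Real.log (2 * Real.pi / 3) = Real.log 2 + Real.log Real.pi - Real.log 3 := by
    rw [Real.log_div (by positivity) (by norm_num), Real.log_mul (by norm_num) hπ.ne']
  have h6 : Real.log 6 = Real.log 2 + Real.log 3 := by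
    rw [show (6 : ℝ) = 2 * 3 by norm_num, Real.log_mul (by norm_num) (by norm_num)]
  rw [hB] at hlog
  rw [h2] at hW
  rw [h6]
  linarith

end Summit.SmoothPoincare4.SmoothPoincare4.Theorems

end
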